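import Literature.AnabelianGeometry.EtaleTheta.Discharge.Sec1Rmk164ContH1ComapAlongCompletion
import Literature.AnabelianGeometry.SemiGraphs.ProfiniteCompletionOfCompact
import Literature.AnabelianGeometry.EtaleTheta.EtaleThetaClass
import HarnessLib

/-!
# [EtTh] Remark 1.6.4 via the Θ-quotient (spec v2): the completion step at `(Π^tp_Ÿ)^Θ` and the
# uniqueness of the profinite class — proof-only

Mochizuki, *The étale theta function and its Frobenioid-theoretic manifestations*, Publ. RIMS **45**
(2009) [EtTh], Remark 1.6.4 p. 252 ("the set of classes `O^×_K̈ · η̈^Θ ∈ H¹(Π^tp_Ÿ, Δ_Θ)` determines, by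
profinite completion, a set of classes `O^×_K̈ · (η̈^Θ)^∧ ∈ H¹(Π_{Ÿ^∧}, Δ_Θ)`") together with Prop. 1.5
(iii) p. 23 ("arises from a unique class in `H¹((Π^tp_Ÿ)^Θ, Δ_Θ)`") [cite: MochizukiEtTh2009, Rmk 1.6.4 p.252]
[cite: MochizukiEtTh2009, Prop 1.5 (iii) p.23]; the cohomology is Neukirch–Schmidt–Wingberg I §2 / II §7
[cite: NeukirchSchmidtWingberg2008, I §2 and II §7] in the tree's carrier `ContH1`.

PROOF-ONLY (abc-iut cell, prover abc-iut-f-128 gen 8, row «RMK164-IOTA-YDD-THETA» file 2/2; L2-lead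
R1227/R1242; no definitions, no facts).  The abc-iut SPEC OF RECORD for Rmk. 1.6.4 (spec v2, L2-lead R1227:
`Π_{Ÿ^∧}` = the CLOSURE of `Π^tp_Ÿ` in `Π_X` — print's bracket "so `Π_X/Π_{Y^∧} ≅ Ẑ`" — NOT an intrinsic
completion, which fails for infinite-index tempered subgroups, `…RestrictNoGo.lean`) routes "determines, by
profinite completion" through the Θ-quotient, where the theta classes live (Prop. 1.5 (iii), the tree's
`ThetaSetting.inflTheta`).  Over the [EtTh] §1 carrier `D : ThetaSetting p` and ANY continuous homomorphism
`ι : (Π^tp_X)^Θ → Ĝ` into a profinite group (the shape of the profinite Θ-quotient datum of the spec; the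
record itself is abc-iut-f-142's `ThetaSetting.HatTheta`, NOT imported here), this file proves:

* `ThetaSetting.isProfiniteCompletion_thetaYdd_of_isCompact` / `exists_…` — if `(Π^tp_Ÿ)^Θ := toTheta(Π^tp_Ÿ)`
  has COMPACT carrier and `ι` is injective on it, the co-restriction `(Π^tp_Ÿ)^Θ → closure ι((Π^tp_Ÿ)^Θ)` is a
  profinite completion — NO cofinality clause (`IsProfiniteCompletion.restrict_of_isCompact`);
* `ThetaSetting.existsUnique_comap_eq_thetaYdd` — consequently every continuous `H¹`-class of `(Π^tp_Ÿ)^Θ`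
  with coefficients in a closed abelian normal `Â ⊴ Ĝ` (action through `ι`) is the pull-back of a UNIQUE class
  of the closure (`ContH1.comap_bijective_of_isProfiniteCompletion`) — the Θ-level «determines, by profinite
  completion»;
* `ThetaSetting.comap_toHat_injective_PiYddHat` — at the `Π`-level, with `Π_{Ÿ^∧} := closure toHat(Π^tp_Ÿ)
  ≤ Π_X` and ANY continuous action `φ̂ : Π_X → Ĝ′` on a Hausdorff coefficient group, a class of
  `H¹(Π_{Ÿ^∧}, Â)` is DETERMINED by its pull-back to `Π^tp_Ÿ` (`ContH1.comap_injective_of_dense`; no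
  hypothesis at all beyond Hausdorffness) — so the profinite class `(η̈^Θ)^∧` of the spec, once produced by
  inflation from the Θ-level, is unique.
The two displayed inputs «`(Π^tp_Ÿ)^Θ` compact» and «`ι` injective on `(Π^tp_Ÿ)^Θ`» are properties of genuine
[EtTh] §1 data ((Δ^tp_Ÿ)^Θ is an extension of the profinite (Δ^tp_Ÿ)^ell — no `ℤ`-factor, `Ÿ → X` kills `Z` —
by `Δ_Θ ≅ Ẑ(1)`); they are NOT derivable from the abstract `ThetaSetting` fields (`toTheta` is only continuous
and surjective there) and are NOT asserted here.  Nothing here bears on [IUTchIII] Cor. 3.12; typed ≠ proved.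
-/

noncomputable section

namespace Literature.AnabelianGeometry.EtaleTheta

open scoped IsMulCommutative
open Topology
open Literature.AnabelianGeometry.SemiGraphs

namespace ThetaSetting

variable {p : ℕ} [Fact p.Prime] (D : ThetaSetting p)

/-! ### The Θ-level completion step: `(Π^tp_Ÿ)^Θ` compact ⟹ its closure in the profinite Θ-quotient is its completion -/

section ThetaLevel

variable {Gh : Type*} [Group Gh] [TopologicalSpace Gh] [IsTopologicalGroup Gh] [T2Space Gh]
  [TotallyDisconnectedSpace Gh]

/-- **`(Π^tp_Ÿ)^Θ → closure ι((Π^tp_Ÿ)^Θ)` is a profinite completion when `(Π^tp_Ÿ)^Θ` is compact.**  For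
`D : ThetaSetting p`, ANY continuous `ι : (Π^tp_X)^Θ → Ĝ` into a Hausdorff totally disconnected group which is
injective on `(Π^tp_Ÿ)^Θ := toTheta(Π^tp_Ÿ)`, and compact carrier of `(Π^tp_Ÿ)^Θ`: a continuous `ιY` into the
closure agreeing with `ι` is a profinite completion — the displayed input «`IsProfiniteCompletion ιYdd`» of the
RMK164 spec v2, WITHOUT any cofinality clause. [cite: MochizukiEtTh2009, Rmk 1.6.4 p.252] -/
theorem isProfiniteCompletion_thetaYdd_of_isCompact (ι : D.GtpTheta →ₜ* Gh)
    (hK : IsCompact ((D.GtpYdd.map D.toTheta : Subgroup D.GtpTheta) : Set D.GtpTheta))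
    (hinj : Set.InjOn ι ((D.GtpYdd.map D.toTheta : Subgroup D.GtpTheta) : Set D.GtpTheta))
    (ιY : (D.GtpYdd.map D.toTheta) →ₜ*
      ↥(((D.GtpYdd.map D.toTheta).map ι.toMonoidHom).topologicalClosure))
    (hιY : ∀ u : D.GtpYdd.map D.toTheta,
      ((ιY u : ↥(((D.GtpYdd.map D.toTheta).map ι.toMonoidHom).topologicalClosure)) : Gh) = ι u) :
    IsProfiniteCompletion ιY :=
  IsProfiniteCompletion.restrict_of_isCompact' ι _ hK hinj ιY hιY

/-- The `∃`-form: under the same two displayed inputs there IS a continuous `ιY : (Π^tp_Ÿ)^Θ → closure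
ι((Π^tp_Ÿ)^Θ)` agreeing with `ι` (the codomain restriction of `ι`), and it is a profinite completion.
[cite: MochizukiEtTh2009, Rmk 1.6.4 p.252] -/
theorem exists_isProfiniteCompletion_thetaYdd_of_isCompact (ι : D.GtpTheta →ₜ* Gh)
    (hK : IsCompact ((D.GtpYdd.map D.toTheta : Subgroup D.GtpTheta) : Set D.GtpTheta))
    (hinj : Set.InjOn ι ((D.GtpYdd.map D.toTheta : Subgroup D.GtpTheta) : Set D.GtpTheta)) :
    ∃ ιY : (D.GtpYdd.map D.toTheta) →ₜ*
        ↥(((D.GtpYdd.map D.toTheta).map ι.toMonoidHom).topologicalClosure),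
      (∀ u : D.GtpYdd.map D.toTheta,
        ((ιY u : ↥(((D.GtpYdd.map D.toTheta).map ι.toMonoidHom).topologicalClosure)) : Gh) = ι u) ∧
      IsProfiniteCompletion ιY := by
  let ιY : (D.GtpYdd.map D.toTheta) →ₜ*
      ↥(((D.GtpYdd.map D.toTheta).map ι.toMonoidHom).topologicalClosure) :=
    { toMonoidHom := (ι.toMonoidHom.comp (D.GtpYdd.map D.toTheta).subtype).codRestrict _ fun u =>
        Subgroup.le_topologicalClosure _ ⟨u, u.2, rfl⟩
      continuous_toFun := (ι.continuous.comp continuous_subtype_val).subtype_mk _ }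
  exact ⟨ιY, fun _ => rfl, D.isProfiniteCompletion_thetaYdd_of_isCompact ι hK hinj ιY fun _ => rfl⟩

/-- **The Θ-level «determines, by profinite completion» (existence and uniqueness).**  With `Ĝ` profinite,
`Â ⊴ Ĝ` closed abelian normal (e.g. `ι(Δ_Θ)`), `(Π^tp_Ÿ)^Θ` compact and `ι` injective on it: every class
`y ∈ H¹((Π^tp_Ÿ)^Θ, Â)` (continuous, action through `ι`) is the pull-back along `ι` of a UNIQUE class
`ŷ ∈ H¹(closure ι((Π^tp_Ÿ)^Θ), Â)` (`ContH1.comap_bijective_of_isProfiniteCompletion`, abc-iut p503502).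
[cite: MochizukiEtTh2009, Rmk 1.6.4 p.252] [cite: NeukirchSchmidtWingberg2008, I §2 and II §7] -/
theorem existsUnique_comap_eq_thetaYdd [CompactSpace Gh] (ι : D.GtpTheta →ₜ* Gh)
    (hK : IsCompact ((D.GtpYdd.map D.toTheta : Subgroup D.GtpTheta) : Set D.GtpTheta))
    (hinj : Set.InjOn ι ((D.GtpYdd.map D.toTheta : Subgroup D.GtpTheta) : Set D.GtpTheta))
    (Ah : Subgroup Gh) [Ah.Normal] [IsMulCommutative Ah] (hA : IsClosed (Ah : Set Gh))
    (y : ContH1 ((MonoidHom.id Gh).comp ι.toMonoidHom) Ah (D.GtpYdd.map D.toTheta)) :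
    ∃! yh : ContH1 (MonoidHom.id Gh) Ah (((D.GtpYdd.map D.toTheta).map ι.toMonoidHom).topologicalClosure),
      ContH1.comap (MonoidHom.id Gh) Ah ι.toMonoidHom ι.continuous
        (Subgroup.le_topologicalClosure _) yh = y := by
  obtain ⟨ιY, hιY, hc⟩ := D.exists_isProfiniteCompletion_thetaYdd_of_isCompact ι hK hinj
  exact (ContH1.comap_bijective_of_isProfiniteCompletion (φ := MonoidHom.id Gh) continuous_id hA
    ι.continuous (Subgroup.le_topologicalClosure _) hιY hc).existsUnique y

end ThetaLevel

/-! ### The `Π`-level uniqueness: a class of `Π_{Ÿ^∧}` is determined by its pull-back to `Π^tp_Ÿ` -/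

section PiLevel

variable {Gh' : Type*} [Group Gh'] [TopologicalSpace Gh'] [IsTopologicalGroup Gh'] [T2Space Gh']

/-- `toHat(Π^tp_Ÿ)` is dense in its closure `Π_{Ÿ^∧} ≤ Π_X` (read inside the closure). [folklore] -/
private theorem dense_preimage_toHat_GtpYdd :
    Dense ((Subtype.val : ↥((D.GtpYdd.map D.toHat.toMonoidHom).topologicalClosure) → D.PiHat) ⁻¹'
      (D.toHat.toMonoidHom '' (D.GtpYdd : Set D.PiTemp))) := by
  rw [Subtype.dense_iff]
  intro w hw
  have hWset : ((((D.GtpYdd.map D.toHat.toMonoidHom).topologicalClosure : Subgroup D.PiHat)) : Set D.PiHat) =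
      closure (D.toHat.toMonoidHom '' (D.GtpYdd : Set D.PiTemp)) := by
    rw [Subgroup.topologicalClosure_coe, Subgroup.coe_map]
  have hw' : w ∈ closure (D.toHat.toMonoidHom '' (D.GtpYdd : Set D.PiTemp)) := by rw [← hWset]; exact hw
  refine closure_mono ?_ hw'
  rintro _ ⟨x, hx, rfl⟩
  have hxW : D.toHat.toMonoidHom x ∈ (D.GtpYdd.map D.toHat.toMonoidHom).topologicalClosure :=
    Subgroup.le_topologicalClosure _ ⟨x, hx, rfl⟩
  exact ⟨⟨D.toHat.toMonoidHom x, hxW⟩, ⟨x, hx, rfl⟩, rfl⟩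

/-- **A class of `H¹(Π_{Ÿ^∧}, Â)` is determined by its restriction to `Π^tp_Ÿ`.**  For `D : ThetaSetting p`,
`Π_{Ÿ^∧} :=` the closure of `toHat(Π^tp_Ÿ)` in `Π_X` (reading of record), ANY continuous `φ̂ : Π_X → Ĝ′` into a
topological group with Hausdorff carrier and any abelian normal `Â ⊴ Ĝ′`: the pull-back
`H¹(Π_{Ÿ^∧}, Â) → H¹(Π^tp_Ÿ, Â)` along `toHat` is injective (`ContH1.comap_injective_of_dense`) — so the profinite
class `(η̈^Θ)^∧` of Rmk. 1.6.4, however produced (spec v2: by inflation from the Θ-level), is UNIQUE among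
classes restricting to `η̈^Θ`. [cite: MochizukiEtTh2009, Rmk 1.6.4 p.252]
[cite: NeukirchSchmidtWingberg2008, I §2 and II §7] -/
theorem comap_toHat_injective_PiYddHat (φh : D.PiHat →* Gh') (hφh : Continuous φh) (Ah : Subgroup Gh')
    [Ah.Normal] [IsMulCommutative Ah] :
    Function.Injective (ContH1.comap φh Ah D.toHat.toMonoidHom D.toHat.continuous
      (Subgroup.le_topologicalClosure (D.GtpYdd.map D.toHat.toMonoidHom)) :
        ContH1 φh Ah ((D.GtpYdd.map D.toHat.toMonoidHom).topologicalClosure) →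
          ContH1 (φh.comp D.toHat.toMonoidHom) Ah D.GtpYdd) :=
  ContH1.comap_injective_of_dense φh hφh Ah D.toHat.toMonoidHom D.toHat.continuous _
    (D.dense_preimage_toHat_GtpYdd)

/-- The same uniqueness, spelled out: two classes of `H¹(Π_{Ÿ^∧}, Â)` with the same pull-back to `Π^tp_Ÿ`
coincide. [cite: MochizukiEtTh2009, Rmk 1.6.4 p.252] -/
theorem eq_of_comap_toHat_eq_PiYddHat (φh : D.PiHat →* Gh') (hφh : Continuous φh) (Ah : Subgroup Gh')
    [Ah.Normal] [IsMulCommutative Ah]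
    (x x' : ContH1 φh Ah ((D.GtpYdd.map D.toHat.toMonoidHom).topologicalClosure))
    (h : ContH1.comap φh Ah D.toHat.toMonoidHom D.toHat.continuous
        (Subgroup.le_topologicalClosure (D.GtpYdd.map D.toHat.toMonoidHom)) x =
      ContH1.comap φh Ah D.toHat.toMonoidHom D.toHat.continuous
        (Subgroup.le_topologicalClosure (D.GtpYdd.map D.toHat.toMonoidHom)) x') :
    x = x' :=
  D.comap_toHat_injective_PiYddHat φh hφh Ah h

end PiLevel

end ThetaSetting

end Literature.AnabelianGeometry.EtaleTheta

end
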